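import Mathlib
import HarnessLib
import Summits.HubbardSuperconductivity.HubbardSuperconductivity.Theorems.KLProgrammeKLRegimeEngineTwoLegSpLegStepSplitRates
import Summits.HubbardSuperconductivity.HubbardSuperconductivity.Theorems.KLProgrammeKLRegimeTwoVolumeDualReadoutRows
import Summits.HubbardSuperconductivity.HubbardSuperconductivity.Theorems.KLProgrammeKLRegimeEngineTwoLegStepV17F2ClosersDual

/-!
# Row C2 (`hsp`) of stubs (e)/(M) of `KLRegimeEngineV17F2` (stmt-HubbardSuperconductivity-20437) at every scale FROM DUAL-LATTICE DATA:
# the complete read-out interface (cell gate-hubbard-kl, seat hubbard-kl-k3c5-p2 g7, β′ lane)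

Composition of this seat's three doors: the one-step split (`…EngineTwoLegSpLegStepSplit`, on private rates `…Rates`), the dual-lattice read-out of
(D) (`…TwoVolumeDualReadout`) and the discharge of its row-invariance hypothesis for the model (`…TwoVolumeDualReadoutRows`).  The result
**`spLeg_allScales_of_dualData_V17F2_rates`** is the literal `hsp` hypothesis of the (e)/(M) closers (`EngineV8.stub_twoLeg_step_of_residuals*`,
history `histV17F2 ∧ TwoLegSlopes`) at every `n ≤ N ≤ nScales β + 1`, from THREE per-scale inputs stated under STEP(n)'s own binders
(thresholds, both histories below `n`, the private rates `a m / L₁` at `m < n`, the frame comparability `|K₁(q) − K₂(q)| ≤ F_n/L₁`):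

* (R) `hgrad n` — `‖D(evalM S₁) q‖ ≤ b n` on the frame-distance tube `{|e_{K₁}(q)| ≤ F_n/L₁}` of the coarse volume's flow frame (the tower's
  two-leg line, row B2 currency up to the frame's own gradient);
* (DUAL) `hdual n` — at SOME pair of pins `(o_c, o_f)`, for the four reading strings `(ω ∈ {ω₀, −ω₀}, σ)`: the `ε`-weighted pinned defect of the
  phase-weighted rows of the dual-lattice two-leg kernels of `𝒱_{L₁}⁽ⁿ⁾[K₁] − 𝒩_{K₁}` and `𝒱_{L₂}⁽ⁿ⁾[K₂] − 𝒩_{K₂}` through the centred lift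
  `≤ Dd n / L₁` and the `ε`-weighted far fine rows `≤ Df n / L₁` (`ε = β/(2M₂)` — the natural `M`-uniform currency of a multiscale tower's
  position-space output);
* the budget `b n·F_n/klCurveD + (F_n + Dd n + Df n) ≤ a n` (`F_n = Σ_{m<n} a m`; the summand `F_n` is the coefficient-`1` frame term of (D)),
  closed to the public ceiling by `a n ≤ Q.CL β n / 4`.

**`spLeg_allScales_of_dualMoments_V17F2_rates`** — the same with (R) ALSO in the dual currency: the off-diagonal first spatial moment `Ms n` of the
coarse volume's separated dual kernel (r2d-p1's `hMs`, the (e) row-B2 datum; `twoLeg_sep_fderiv_of_dual_offDiag_moment` gives a GLOBAL gradient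
`2·Ms n`, the frame adds `4/3·Gfr₁U²` — no tube condition at all) — so row C2 at `n ≥ 1` reads ONLY dual-lattice two-leg data of the two volumes.
**`spLeg_allScales_of_dualMoments_V17F2_geometric`** — the budget bookkeeping discharged on GEOMETRIC private rates `d·3^n` (`0 ≤ d ≤ Q.CL β 0/4`,
`Q.CL β 0·4^n ≤ Q.CL β n`): the supplier owes only `2·Ms n + 4/3·Gfr₁U² ≤ klCurveD` and `Dd n + Df n ≤ d` per scale (`sum_range_mul_three_pow`,
`sum_geometricRates_le_klScale_mul` — the frame-distance tube of these rates sits inside the shell once `16·d·12^n ≤ L`).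

Proofs only (one composition); no definitions; nothing about the model is asserted; nothing asserts superconductivity.
References: BGM 2006 §2.1 (2.4)–(2.5), §2.4 (2.23), Lemma 2.1 (2.40) [cite: BenfattoGiulianiMastropietro2006].
-/

noncomputable section

namespace Summit.HubbardSuperconductivity.HubbardSuperconductivity.Theorems.EngineV8

set_option linter.dupNamespace false -- summit = problem name (single-conjunct summit), D-0017

open Real Finset Complex Literature.MathematicalPhysics.QuantumLattice Literature.Probability.LatticeModels GrassmannAlgebra
open Summit.HubbardSuperconductivity.HubbardSuperconductivity.Theorems.KLProgrammeLegKernels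
open Summit.HubbardSuperconductivity.HubbardSuperconductivity.Theorems.DispersionFlow
open Summit.HubbardSuperconductivity.HubbardSuperconductivity.Theorems.PerturbedFermiCurve
open Summit.HubbardSuperconductivity.HubbardSuperconductivity.Theorems.KLRegimeSplit
open Summit.HubbardSuperconductivity.HubbardSuperconductivity.Theorems.TwoPointAssembly
open Summit.HubbardSuperconductivity.HubbardSuperconductivity.Theorems.TwoVolumeDefect
open Summit.HubbardSuperconductivity.HubbardSuperconductivity.Theorems.TwoLegFourier

section V17F2

variable {L : ℕ} {G : GeoConsts} {P : SplitConsts} {Q : EngConsts} {R : RenConsts} {β U μ c : ℝ}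

/-- **ROW C2 (`hsp`) AT EVERY SCALE `n ≤ N ≤ nScales β + 1` FROM THE READING GRADIENT AND DUAL-LATTICE DEFECT DATA, private rates** (KL regime,
`0 ≤ Gfr`, bare frame admissible `h0`, `klEngL₃ β U ≤ L` for the degree guard of the flow frames): see the module docstring for (R) `hgrad`,
(DUAL) `hdual` and the budget.  Conclusion: the literal `hsp` of the (e)/(M) closers (history `histV17F2 ∧ TwoLegSlopes` at `(G, P, Q, R)`). -/
theorem spLeg_allScales_of_dualData_V17F2_rates (hR : ∀ j, 0 ≤ R.Gfr j) (hc : 0 < c) (hcle : c ≤ klCurveC3 R) (hU : 0 < U)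
    (hUle : U ≤ klCurveU0 R) (hβmin : klBetaMin ≤ β) (hβc : β ≤ Real.exp (c / U ^ 2)) (hμ : μ ∈ klWindowC) (hL : klEngL₃ β U ≤ L)
    (h0 : FrameOK R U (nScales β) μ 0) {N : ℕ} (hN : N ≤ nScales β + 1) {a b Dd Df : ℕ → ℝ} (ha : ∀ n ≤ N, a n ≤ Q.CL β n / 4)
    (hb : ∀ n ≤ N, 0 ≤ b n)
    (hgrad : ∀ n ≤ N, ∀ (Mq : ℕ → ℕ) (L₁ L₂ M₂ : ℕ) [NeZero L₁] [NeZero L₂] [NeZero M₂], L ≤ L₁ → L₁ ∣ L₂ → Q.M0 β L₁ ≤ M₂ →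
      Mq L₁ ≤ M₂ → Q.M0 β L₂ ≤ M₂ → Mq L₂ ≤ M₂ →
      (∀ j < n, histV17F2 L₁ M₂ G P Q R β U μ j ∧ TwoLegSlopes L₁ M₂ R β U μ (klFlowFrameU L₁ M₂ β U μ j) j) →
      (∀ j < n, histV17F2 L₂ M₂ G P Q R β U μ j ∧ TwoLegSlopes L₂ M₂ R β U μ (klFlowFrameU L₂ M₂ β U μ j) j) →
      (∀ m < n, ∀ θ : ℝ, |klLocalPart L₁ M₂ β U μ (klFlowFrameU L₁ M₂ β U μ m) m θ -
        klLocalPart L₂ M₂ β U μ (klFlowFrameU L₂ M₂ β U μ m) m θ| ≤ a m / L₁) →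
      (∀ q : Fin 2 → ℝ, |(klFlowFrameU L₁ M₂ β U μ n).eval q - (klFlowFrameU L₂ M₂ β U μ n).eval q| ≤ (∑ m ∈ range n, a m) / L₁) →
        ∀ q : Momentum, |frameLevel μ (klFlowFrameU L₁ M₂ β U μ n) q| ≤ (∑ m ∈ range n, a m) / L₁ →
          ‖fderiv ℝ (evalM (symInterp L₁ (klLocSelfEnergyRe L₁ M₂ β U μ (klFlowFrameU L₁ M₂ β U μ n) n))) q‖ ≤ b n)
    (hdual : ∀ n ≤ N, ∀ (Mq : ℕ → ℕ) (L₁ L₂ M₂ : ℕ) [NeZero L₁] [NeZero L₂] [NeZero M₂], L ≤ L₁ → L₁ ∣ L₂ → Q.M0 β L₁ ≤ M₂ →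
      Mq L₁ ≤ M₂ → Q.M0 β L₂ ≤ M₂ → Mq L₂ ≤ M₂ →
      (∀ j < n, histV17F2 L₁ M₂ G P Q R β U μ j ∧ TwoLegSlopes L₁ M₂ R β U μ (klFlowFrameU L₁ M₂ β U μ j) j) →
      (∀ j < n, histV17F2 L₂ M₂ G P Q R β U μ j ∧ TwoLegSlopes L₂ M₂ R β U μ (klFlowFrameU L₂ M₂ β U μ j) j) →
      (∀ m < n, ∀ θ : ℝ, |klLocalPart L₁ M₂ β U μ (klFlowFrameU L₁ M₂ β U μ m) m θ -
        klLocalPart L₂ M₂ β U μ (klFlowFrameU L₂ M₂ β U μ m) m θ| ≤ a m / L₁) →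
      (∀ q : Fin 2 → ℝ, |(klFlowFrameU L₁ M₂ β U μ n).eval q - (klFlowFrameU L₂ M₂ β U μ n).eval q| ≤ (∑ m ∈ range n, a m) / L₁) →
      ∃ (oc : SpaceTimeIdx L₁ M₂) (of : SpaceTimeIdx L₂ M₂),
        (∀ m ∈ ({omega0 M₂, (omega0 M₂).rev} : Finset (MatsubaraIdx M₂)), ∀ σ : Fin 2, imagTimeWeight β M₂ * ∑ ybar : TorusSite 2 L₁,
          (‖(∑ t₁ : ImagTimeIdx M₂,
              sectorisedKernel L₁ M₂ β (trivialMultiplier L₁ M₂)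
                  (klEffectiveAction L₁ M₂ β U μ (klFlowFrameU L₁ M₂ β U μ n) klE0 n - counterQuadratic L₁ M₂ β (klFlowFrameU L₁ M₂ β U μ n)) 2
                  (![((0, σ), 0), ((0, σ), 1)] : Fin 2 → SectorLeg 1) ![oc, (t₁, oc.2 + ybar)] *
                Complex.exp (((matsubaraFreq β M₂ m * (imagTime β M₂ oc.1 - imagTime β M₂ t₁) : ℝ) : ℂ) * I)) -
            (∑ t₁ : ImagTimeIdx M₂,
              sectorisedKernel L₂ M₂ β (trivialMultiplier L₂ M₂)
                  (klEffectiveAction L₂ M₂ β U μ (klFlowFrameU L₂ M₂ β U μ n) klE0 n - counterQuadratic L₂ M₂ β (klFlowFrameU L₂ M₂ β U μ n)) 2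
                  (![((0, σ), 0), ((0, σ), 1)] : Fin 2 → SectorLeg 1) ![of, (t₁, of.2 + Torus.proj L₂ (Torus.cRep ybar))] *
                Complex.exp (((matsubaraFreq β M₂ m * (imagTime β M₂ of.1 - imagTime β M₂ t₁) : ℝ) : ℂ) * I))‖ +
          ‖(∑ t₁ : ImagTimeIdx M₂,
              sectorisedKernel L₁ M₂ β (trivialMultiplier L₁ M₂)
                  (klEffectiveAction L₁ M₂ β U μ (klFlowFrameU L₁ M₂ β U μ n) klE0 n - counterQuadratic L₁ M₂ β (klFlowFrameU L₁ M₂ β U μ n)) 2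
                  (![((0, σ), 0), ((0, σ), 1)] : Fin 2 → SectorLeg 1) ![oc, (t₁, oc.2 + -ybar)] *
                Complex.exp (((matsubaraFreq β M₂ m * (imagTime β M₂ oc.1 - imagTime β M₂ t₁) : ℝ) : ℂ) * I)) -
            (∑ t₁ : ImagTimeIdx M₂,
              sectorisedKernel L₂ M₂ β (trivialMultiplier L₂ M₂)
                  (klEffectiveAction L₂ M₂ β U μ (klFlowFrameU L₂ M₂ β U μ n) klE0 n - counterQuadratic L₂ M₂ β (klFlowFrameU L₂ M₂ β U μ n)) 2
                  (![((0, σ), 0), ((0, σ), 1)] : Fin 2 → SectorLeg 1) ![of, (t₁, of.2 + -Torus.proj L₂ (Torus.cRep ybar))] *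
                Complex.exp (((matsubaraFreq β M₂ m * (imagTime β M₂ of.1 - imagTime β M₂ t₁) : ℝ) : ℂ) * I))‖) ≤ Dd n / L₁) ∧
        (∀ m ∈ ({omega0 M₂, (omega0 M₂).rev} : Finset (MatsubaraIdx M₂)), ∀ σ : Fin 2, imagTimeWeight β M₂ *
          ∑ y ∈ univ.filter (fun y : TorusSite 2 L₂ => Torus.proj L₂ (Torus.cRep (fun i => (((y i).val : ℕ) : ZMod L₁))) ≠ y),
          (‖(∑ t₁ : ImagTimeIdx M₂,
              sectorisedKernel L₂ M₂ β (trivialMultiplier L₂ M₂)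
                  (klEffectiveAction L₂ M₂ β U μ (klFlowFrameU L₂ M₂ β U μ n) klE0 n - counterQuadratic L₂ M₂ β (klFlowFrameU L₂ M₂ β U μ n)) 2
                  (![((0, σ), 0), ((0, σ), 1)] : Fin 2 → SectorLeg 1) ![of, (t₁, of.2 + y)] *
                Complex.exp (((matsubaraFreq β M₂ m * (imagTime β M₂ of.1 - imagTime β M₂ t₁) : ℝ) : ℂ) * I))‖ +
          ‖(∑ t₁ : ImagTimeIdx M₂,
              sectorisedKernel L₂ M₂ β (trivialMultiplier L₂ M₂)
                  (klEffectiveAction L₂ M₂ β U μ (klFlowFrameU L₂ M₂ β U μ n) klE0 n - counterQuadratic L₂ M₂ β (klFlowFrameU L₂ M₂ β U μ n)) 2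
                  (![((0, σ), 0), ((0, σ), 1)] : Fin 2 → SectorLeg 1) ![of, (t₁, of.2 + -y)] *
                Complex.exp (((matsubaraFreq β M₂ m * (imagTime β M₂ of.1 - imagTime β M₂ t₁) : ℝ) : ℂ) * I))‖) ≤ Df n / L₁))
    (hbudget : ∀ n ≤ N, b n * (∑ m ∈ range n, a m) / klCurveD + ((∑ m ∈ range n, a m) + Dd n + Df n) ≤ a n) :
    ∀ n ≤ N, ∀ (Mq : ℕ → ℕ) (L₁ L₂ M₂ : ℕ) [NeZero L₁] [NeZero L₂] [NeZero M₂], L ≤ L₁ → L₁ ∣ L₂ → Q.M0 β L₁ ≤ M₂ → Mq L₁ ≤ M₂ →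
      Q.M0 β L₂ ≤ M₂ → Mq L₂ ≤ M₂ →
      (∀ j < n, histV17F2 L₁ M₂ G P Q R β U μ j ∧ TwoLegSlopes L₁ M₂ R β U μ (klFlowFrameU L₁ M₂ β U μ j) j) →
      (∀ j < n, histV17F2 L₂ M₂ G P Q R β U μ j ∧ TwoLegSlopes L₂ M₂ R β U μ (klFlowFrameU L₂ M₂ β U μ j) j) →
        ∀ θ : ℝ, |klLocalPart L₁ M₂ β U μ (klFlowFrameU L₁ M₂ β U μ n) n θ -
          klLocalPart L₂ M₂ β U μ (klFlowFrameU L₂ M₂ β U μ n) n θ| ≤ Q.CL β n / 4 / L₁ := by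
  have hβ0 : 0 < β := lt_of_lt_of_le (by norm_num [klBetaMin]) hβmin
  refine spLeg_allScales_of_pointDefects_V17F2_rates (G := G) (P := P) (d := fun n => (∑ m ∈ range n, a m) + Dd n + Df n)
    hR hc hcle hU hUle hβmin hβc hμ h0 hN ha hb hgrad ?_ hbudget
  intro n hn Mq L₁ L₂ M₂ _ _ _ hLL₁ hdvd hM₁ hMq₁ hM₂ hMq₂ hh₁ hh₂ hrates hframe θ
  obtain ⟨b', hb'⟩ := hdvd
  have hL' : L₂ = b' * L₁ := by rw [hb', mul_comm]
  have hLL₂ : L ≤ L₂ := hLL₁.trans (Nat.le_of_dvd (Nat.pos_of_ne_zero (NeZero.ne L₂)) ⟨b', hb'⟩)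
  have hL₁0 : (0 : ℝ) < L₁ := by exact_mod_cast Nat.pos_of_ne_zero (NeZero.ne L₁)
  have hε : 0 < imagTimeWeight β M₂ := by
    unfold imagTimeWeight
    have : (0 : ℝ) < M₂ := by exact_mod_cast Nat.pos_of_ne_zero (NeZero.ne M₂)
    positivity
  -- degree guards of the two flow frames
  have hK₁ := frameOK_klFlowFrameU_of_histV17F2 (L' := L₁) (M' := M₂) hR h0 (hn.trans hN) hh₁
  have hK₂ := frameOK_klFlowFrameU_of_histV17F2 (L' := L₂) (M' := M₂) hR h0 (hn.trans hN) hh₂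
  have hdeg₁ : (klFlowFrameU L₁ M₂ β U μ n).degree ≤ L₁ / 2 :=
    (frameOKDeg_klFlowFrameU hK₁ (hn.trans hN)).degree_le_half rfl hβmin (hL.trans hLL₁)
  have hdeg₂ : (klFlowFrameU L₂ M₂ β U μ n).degree ≤ L₂ / 2 :=
    (frameOKDeg_klFlowFrameU hK₂ (hn.trans hN)).degree_le_half rfl hβmin (hL.trans hLL₂)
  -- the dual data at the supplier's pins, rescaled by `ε`
  obtain ⟨oc, of, hdef, hfar⟩ := hdual n hn Mq L₁ L₂ M₂ hLL₁ ⟨b', hb'⟩ hM₁ hMq₁ hM₂ hMq₂ hh₁ hh₂ hrates hframe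
  have hdef' := fun m hm σ => (le_div_iff₀' hε).2 (hdef m hm σ)
  have hfar' := fun m hm σ => (le_div_iff₀' hε).2 (hfar m hm σ)
  have hD := abs_symInterp_locRe_sub_le_frame_add_dualDefect' (M := M₂) hL' hβ0 U μ hdeg₁ hdeg₂ n oc of hdef' hfar'
    (klFermiPoint μ (klFlowFrameU L₂ M₂ β U μ n) θ)
  refine hD.trans ?_
  have hKq := hframe (klFermiPoint μ (klFlowFrameU L₂ M₂ β U μ n) θ)
  have hεsimp : imagTimeWeight β M₂ * (Dd n / L₁ / imagTimeWeight β M₂ + Df n / L₁ / imagTimeWeight β M₂) = (Dd n + Df n) / L₁ := by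
    field_simp
  rw [hεsimp]
  have hsum : (∑ m ∈ range n, a m) / L₁ + (Dd n + Df n) / L₁ = ((∑ m ∈ range n, a m) + Dd n + Df n) / L₁ := by
    field_simp
    ring
  linarith [hsum]


/-- **ROW C2 (`hsp`) AT EVERY SCALE FROM DUAL-LATTICE TWO-LEG DATA ONLY, private rates**: as `spLeg_allScales_of_dualData_V17F2_rates`, with the
reading gradient (R) replaced by the off-diagonal first spatial moment `Ms n ≥ 0` of the dual kernel of the COARSE volume's separated data
`𝒱_{L₁}⁽ⁿ⁾[K₁] − 𝒩_{K₁}` (both spins, every pin; r2d-p1's `hMs` shape) — the gradient is then GLOBAL (`2·Ms n + 4/3·Gfr₁U²`), so no tube condition is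
needed; budget `(2·Ms n + 4/3·Gfr₁U²)·F_n/klCurveD + (F_n + Dd n + Df n) ≤ a n`. -/
theorem spLeg_allScales_of_dualMoments_V17F2_rates (hR : ∀ j, 0 ≤ R.Gfr j) (hc : 0 < c) (hcle : c ≤ klCurveC3 R) (hU : 0 < U)
    (hUle : U ≤ klCurveU0 R) (hβmin : klBetaMin ≤ β) (hβc : β ≤ Real.exp (c / U ^ 2)) (hμ : μ ∈ klWindowC) (hL : klEngL₃ β U ≤ L)
    (h0 : FrameOK R U (nScales β) μ 0) {N : ℕ} (hN : N ≤ nScales β + 1) {a Ms Dd Df : ℕ → ℝ} (ha : ∀ n ≤ N, a n ≤ Q.CL β n / 4)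
    (hMs0 : ∀ n ≤ N, 0 ≤ Ms n)
    (hMs : ∀ n ≤ N, ∀ (Mq : ℕ → ℕ) (L₁ L₂ M₂ : ℕ) [NeZero L₁] [NeZero L₂] [NeZero M₂], L ≤ L₁ → L₁ ∣ L₂ → Q.M0 β L₁ ≤ M₂ →
      Mq L₁ ≤ M₂ → Q.M0 β L₂ ≤ M₂ → Mq L₂ ≤ M₂ →
      (∀ j < n, histV17F2 L₁ M₂ G P Q R β U μ j ∧ TwoLegSlopes L₁ M₂ R β U μ (klFlowFrameU L₁ M₂ β U μ j) j) →
      (∀ j < n, histV17F2 L₂ M₂ G P Q R β U μ j ∧ TwoLegSlopes L₂ M₂ R β U μ (klFlowFrameU L₂ M₂ β U μ j) j) →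
      (∀ m < n, ∀ θ : ℝ, |klLocalPart L₁ M₂ β U μ (klFlowFrameU L₁ M₂ β U μ m) m θ -
        klLocalPart L₂ M₂ β U μ (klFlowFrameU L₂ M₂ β U μ m) m θ| ≤ a m / L₁) →
      (∀ q : Fin 2 → ℝ, |(klFlowFrameU L₁ M₂ β U μ n).eval q - (klFlowFrameU L₂ M₂ β U μ n).eval q| ≤ (∑ m ∈ range n, a m) / L₁) →
        ∀ (σ : Fin 2) (x₀ : SpaceTimeIdx L₁ M₂), imagTimeWeight β M₂ *
          ∑ x ∈ (univ : Finset (Fin 2 → SpaceTimeIdx L₁ M₂)).filter (fun x => x 0 = x₀ ∧ (x 1).2 ≠ (x 0).2),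
            (1 + ((((x 1).2 - (x 0).2) 0).valMinAbs.natAbs : ℝ) + ((((x 1).2 - (x 0).2) 1).valMinAbs.natAbs : ℝ)) ^ 1 *
              ‖sectorisedKernel L₁ M₂ β (trivialMultiplier L₁ M₂)
                  (klEffectiveAction L₁ M₂ β U μ (klFlowFrameU L₁ M₂ β U μ n) klE0 n - counterQuadratic L₁ M₂ β (klFlowFrameU L₁ M₂ β U μ n)) 2
                  (![((0, σ), 0), ((0, σ), 1)] : Fin 2 → SectorLeg 1) x‖ ≤ Ms n)
    (hdual : ∀ n ≤ N, ∀ (Mq : ℕ → ℕ) (L₁ L₂ M₂ : ℕ) [NeZero L₁] [NeZero L₂] [NeZero M₂], L ≤ L₁ → L₁ ∣ L₂ → Q.M0 β L₁ ≤ M₂ →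
      Mq L₁ ≤ M₂ → Q.M0 β L₂ ≤ M₂ → Mq L₂ ≤ M₂ →
      (∀ j < n, histV17F2 L₁ M₂ G P Q R β U μ j ∧ TwoLegSlopes L₁ M₂ R β U μ (klFlowFrameU L₁ M₂ β U μ j) j) →
      (∀ j < n, histV17F2 L₂ M₂ G P Q R β U μ j ∧ TwoLegSlopes L₂ M₂ R β U μ (klFlowFrameU L₂ M₂ β U μ j) j) →
      (∀ m < n, ∀ θ : ℝ, |klLocalPart L₁ M₂ β U μ (klFlowFrameU L₁ M₂ β U μ m) m θ -
        klLocalPart L₂ M₂ β U μ (klFlowFrameU L₂ M₂ β U μ m) m θ| ≤ a m / L₁) →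
      (∀ q : Fin 2 → ℝ, |(klFlowFrameU L₁ M₂ β U μ n).eval q - (klFlowFrameU L₂ M₂ β U μ n).eval q| ≤ (∑ m ∈ range n, a m) / L₁) →
      ∃ (oc : SpaceTimeIdx L₁ M₂) (of : SpaceTimeIdx L₂ M₂),
        (∀ m ∈ ({omega0 M₂, (omega0 M₂).rev} : Finset (MatsubaraIdx M₂)), ∀ σ : Fin 2, imagTimeWeight β M₂ * ∑ ybar : TorusSite 2 L₁,
          (‖(∑ t₁ : ImagTimeIdx M₂,
              sectorisedKernel L₁ M₂ β (trivialMultiplier L₁ M₂)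
                  (klEffectiveAction L₁ M₂ β U μ (klFlowFrameU L₁ M₂ β U μ n) klE0 n - counterQuadratic L₁ M₂ β (klFlowFrameU L₁ M₂ β U μ n)) 2
                  (![((0, σ), 0), ((0, σ), 1)] : Fin 2 → SectorLeg 1) ![oc, (t₁, oc.2 + ybar)] *
                Complex.exp (((matsubaraFreq β M₂ m * (imagTime β M₂ oc.1 - imagTime β M₂ t₁) : ℝ) : ℂ) * I)) -
            (∑ t₁ : ImagTimeIdx M₂,
              sectorisedKernel L₂ M₂ β (trivialMultiplier L₂ M₂)
                  (klEffectiveAction L₂ M₂ β U μ (klFlowFrameU L₂ M₂ β U μ n) klE0 n - counterQuadratic L₂ M₂ β (klFlowFrameU L₂ M₂ β U μ n)) 2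
                  (![((0, σ), 0), ((0, σ), 1)] : Fin 2 → SectorLeg 1) ![of, (t₁, of.2 + Torus.proj L₂ (Torus.cRep ybar))] *
                Complex.exp (((matsubaraFreq β M₂ m * (imagTime β M₂ of.1 - imagTime β M₂ t₁) : ℝ) : ℂ) * I))‖ +
          ‖(∑ t₁ : ImagTimeIdx M₂,
              sectorisedKernel L₁ M₂ β (trivialMultiplier L₁ M₂)
                  (klEffectiveAction L₁ M₂ β U μ (klFlowFrameU L₁ M₂ β U μ n) klE0 n - counterQuadratic L₁ M₂ β (klFlowFrameU L₁ M₂ β U μ n)) 2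
                  (![((0, σ), 0), ((0, σ), 1)] : Fin 2 → SectorLeg 1) ![oc, (t₁, oc.2 + -ybar)] *
                Complex.exp (((matsubaraFreq β M₂ m * (imagTime β M₂ oc.1 - imagTime β M₂ t₁) : ℝ) : ℂ) * I)) -
            (∑ t₁ : ImagTimeIdx M₂,
              sectorisedKernel L₂ M₂ β (trivialMultiplier L₂ M₂)
                  (klEffectiveAction L₂ M₂ β U μ (klFlowFrameU L₂ M₂ β U μ n) klE0 n - counterQuadratic L₂ M₂ β (klFlowFrameU L₂ M₂ β U μ n)) 2
                  (![((0, σ), 0), ((0, σ), 1)] : Fin 2 → SectorLeg 1) ![of, (t₁, of.2 + -Torus.proj L₂ (Torus.cRep ybar))] *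
                Complex.exp (((matsubaraFreq β M₂ m * (imagTime β M₂ of.1 - imagTime β M₂ t₁) : ℝ) : ℂ) * I))‖) ≤ Dd n / L₁) ∧
        (∀ m ∈ ({omega0 M₂, (omega0 M₂).rev} : Finset (MatsubaraIdx M₂)), ∀ σ : Fin 2, imagTimeWeight β M₂ *
          ∑ y ∈ univ.filter (fun y : TorusSite 2 L₂ => Torus.proj L₂ (Torus.cRep (fun i => (((y i).val : ℕ) : ZMod L₁))) ≠ y),
          (‖(∑ t₁ : ImagTimeIdx M₂,
              sectorisedKernel L₂ M₂ β (trivialMultiplier L₂ M₂)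
                  (klEffectiveAction L₂ M₂ β U μ (klFlowFrameU L₂ M₂ β U μ n) klE0 n - counterQuadratic L₂ M₂ β (klFlowFrameU L₂ M₂ β U μ n)) 2
                  (![((0, σ), 0), ((0, σ), 1)] : Fin 2 → SectorLeg 1) ![of, (t₁, of.2 + y)] *
                Complex.exp (((matsubaraFreq β M₂ m * (imagTime β M₂ of.1 - imagTime β M₂ t₁) : ℝ) : ℂ) * I))‖ +
          ‖(∑ t₁ : ImagTimeIdx M₂,
              sectorisedKernel L₂ M₂ β (trivialMultiplier L₂ M₂)
                  (klEffectiveAction L₂ M₂ β U μ (klFlowFrameU L₂ M₂ β U μ n) klE0 n - counterQuadratic L₂ M₂ β (klFlowFrameU L₂ M₂ β U μ n)) 2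
                  (![((0, σ), 0), ((0, σ), 1)] : Fin 2 → SectorLeg 1) ![of, (t₁, of.2 + -y)] *
                Complex.exp (((matsubaraFreq β M₂ m * (imagTime β M₂ of.1 - imagTime β M₂ t₁) : ℝ) : ℂ) * I))‖) ≤ Df n / L₁))
    (hbudget : ∀ n ≤ N, (2 * Ms n + 4 / 3 * R.Gfr 1 * U ^ 2) * (∑ m ∈ range n, a m) / klCurveD + ((∑ m ∈ range n, a m) + Dd n + Df n) ≤ a n) :
    ∀ n ≤ N, ∀ (Mq : ℕ → ℕ) (L₁ L₂ M₂ : ℕ) [NeZero L₁] [NeZero L₂] [NeZero M₂], L ≤ L₁ → L₁ ∣ L₂ → Q.M0 β L₁ ≤ M₂ → Mq L₁ ≤ M₂ →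
      Q.M0 β L₂ ≤ M₂ → Mq L₂ ≤ M₂ →
      (∀ j < n, histV17F2 L₁ M₂ G P Q R β U μ j ∧ TwoLegSlopes L₁ M₂ R β U μ (klFlowFrameU L₁ M₂ β U μ j) j) →
      (∀ j < n, histV17F2 L₂ M₂ G P Q R β U μ j ∧ TwoLegSlopes L₂ M₂ R β U μ (klFlowFrameU L₂ M₂ β U μ j) j) →
        ∀ θ : ℝ, |klLocalPart L₁ M₂ β U μ (klFlowFrameU L₁ M₂ β U μ n) n θ -
          klLocalPart L₂ M₂ β U μ (klFlowFrameU L₂ M₂ β U μ n) n θ| ≤ Q.CL β n / 4 / L₁ := by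
  have hβ0 : 0 < β := lt_of_lt_of_le (by norm_num [klBetaMin]) hβmin
  have h13 : 0 ≤ 4 / 3 * R.Gfr 1 * U ^ 2 := by have := hR 1; positivity
  refine spLeg_allScales_of_dualData_V17F2_rates (G := G) (P := P) (b := fun n => 2 * Ms n + 4 / 3 * R.Gfr 1 * U ^ 2)
    hR hc hcle hU hUle hβmin hβc hμ hL h0 hN ha (fun n hn => by have := hMs0 n hn; positivity) ?_ hdual hbudget
  intro n hn Mq L₁ L₂ M₂ _ _ _ hLL₁ hdvd hM₁ hMq₁ hM₂ hMq₂ hh₁ hh₂ hrates hframe q _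
  have hK₁ := frameOK_klFlowFrameU_of_histV17F2 (L' := L₁) (M' := M₂) hR h0 (hn.trans hN) hh₁
  have hdeg₁ : (klFlowFrameU L₁ M₂ β U μ n).degree ≤ L₁ / 2 :=
    (frameOKDeg_klFlowFrameU hK₁ (hn.trans hN)).degree_le_half rfl hβmin (hL.trans hLL₁)
  have hsep := twoLeg_sep_fderiv_of_dual_offDiag_moment (L := L₁) (M := M₂) hβ0 U μ (klFlowFrameU L₁ M₂ β U μ n) n
    (hMs n hn Mq L₁ L₂ M₂ hLL₁ hdvd hM₁ hMq₁ hM₂ hMq₂ hh₁ hh₂ hrates hframe) q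
  refine (norm_fderiv_evalM_symInterp_le_of_sep_at (L := L₁) (M := M₂) hdeg₁ β U μ n q hsep).trans ?_
  linarith [norm_iteratedFDeriv_one_frameShift_le_of_frameOK hR hK₁ q]


/-- Geometric private rates `a m = d·3^m`: `F_n = Σ_{m<n} d·3^m = d·(3^n − 1)/2`. -/
theorem sum_range_mul_three_pow (d : ℝ) (n : ℕ) : ∑ m ∈ range n, d * (3 : ℝ) ^ m = d * ((3 : ℝ) ^ n - 1) / 2 := by
  rw [← mul_sum, geom_sum_eq (by norm_num : (3 : ℝ) ≠ 1) n]
  ring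

/-- **The frame-distance tube of geometric private rates sits inside the shell**: `16·d·12^n ≤ L ⟹ Σ_{m<n} d·3^m ≤ Λ_n·L` (`Λ_n = 4^{-n}/32`,
`0 ≤ d`) — the side condition `hFΛ` of `spLeg_step_of_pointDefect_sepTubeGradient_hist` on the rates `d·3^m`. -/
theorem sum_geometricRates_le_klScale_mul {d : ℝ} (hd : 0 ≤ d) {n : ℕ} {Lr : ℝ} (hL : 16 * d * (12 : ℝ) ^ n ≤ Lr) :
    ∑ m ∈ range n, d * (3 : ℝ) ^ m ≤ klScale klE0 n * Lr := by
  rw [sum_range_mul_three_pow]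
  unfold klScale klE0
  have h4 : (0 : ℝ) < (4 : ℝ) ^ n := by positivity
  have h12 : (12 : ℝ) ^ n = (3 : ℝ) ^ n * (4 : ℝ) ^ n := by rw [← mul_pow]; norm_num
  rw [h12] at hL
  have h3 : (0 : ℝ) ≤ d * (3 : ℝ) ^ n := by positivity
  -- `d(3^n − 1)/2 ≤ d·3^n/2 ≤ Lr/(32·4^n)`
  have hkey : d * (3 : ℝ) ^ n / 2 ≤ 1 / 32 * ((4 : ℝ) ^ n)⁻¹ * Lr := by
    rw [show 1 / 32 * ((4 : ℝ) ^ n)⁻¹ * Lr = Lr / (32 * (4 : ℝ) ^ n) by field_simp, le_div_iff₀ (by positivity)]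
    nlinarith
  have hsub : d * ((3 : ℝ) ^ n - 1) / 2 ≤ d * (3 : ℝ) ^ n / 2 := by nlinarith
  exact hsub.trans hkey

/-- **ROW C2 (`hsp`) AT EVERY SCALE ON GEOMETRIC PRIVATE RATES `d·3^n` FROM DUAL-LATTICE DATA — budget bookkeeping discharged**: with
`0 ≤ d ≤ Q.CL β 0/4`, `Q.CL β 0·4^n ≤ Q.CL β n` (equality for the `klEngQ*` packages), the per-scale smallness `2·Ms n + 4/3·Gfr₁U² ≤ klCurveD` of the
coarse reading's gradient datum and the per-scale dual defect data with `Dd n + Df n ≤ d` (rates `d·3^m` inside the binders), the literal `hsp` of the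
(e)/(M) closers holds at every `n ≤ N ≤ nScales β + 1`. -/
theorem spLeg_allScales_of_dualMoments_V17F2_geometric (hR : ∀ j, 0 ≤ R.Gfr j) (hc : 0 < c) (hcle : c ≤ klCurveC3 R) (hU : 0 < U)
    (hUle : U ≤ klCurveU0 R) (hβmin : klBetaMin ≤ β) (hβc : β ≤ Real.exp (c / U ^ 2)) (hμ : μ ∈ klWindowC) (hL : klEngL₃ β U ≤ L)
    (h0 : FrameOK R U (nScales β) μ 0) {N : ℕ} (hN : N ≤ nScales β + 1) {d : ℝ} (hd : 0 ≤ d) (hdCL : d ≤ Q.CL β 0 / 4)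
    (hCL : ∀ n ≤ N, Q.CL β 0 * (4 : ℝ) ^ n ≤ Q.CL β n) {Ms Dd Df : ℕ → ℝ} (hMs0 : ∀ n ≤ N, 0 ≤ Ms n)
    (hsmall : ∀ n ≤ N, 2 * Ms n + 4 / 3 * R.Gfr 1 * U ^ 2 ≤ klCurveD) (hDsum : ∀ n ≤ N, Dd n + Df n ≤ d)
    (hMs : ∀ n ≤ N, ∀ (Mq : ℕ → ℕ) (L₁ L₂ M₂ : ℕ) [NeZero L₁] [NeZero L₂] [NeZero M₂], L ≤ L₁ → L₁ ∣ L₂ → Q.M0 β L₁ ≤ M₂ →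
      Mq L₁ ≤ M₂ → Q.M0 β L₂ ≤ M₂ → Mq L₂ ≤ M₂ →
      (∀ j < n, histV17F2 L₁ M₂ G P Q R β U μ j ∧ TwoLegSlopes L₁ M₂ R β U μ (klFlowFrameU L₁ M₂ β U μ j) j) →
      (∀ j < n, histV17F2 L₂ M₂ G P Q R β U μ j ∧ TwoLegSlopes L₂ M₂ R β U μ (klFlowFrameU L₂ M₂ β U μ j) j) →
      (∀ m < n, ∀ θ : ℝ, |klLocalPart L₁ M₂ β U μ (klFlowFrameU L₁ M₂ β U μ m) m θ -
        klLocalPart L₂ M₂ β U μ (klFlowFrameU L₂ M₂ β U μ m) m θ| ≤ d * (3 : ℝ) ^ m / L₁) →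
      (∀ q : Fin 2 → ℝ, |(klFlowFrameU L₁ M₂ β U μ n).eval q - (klFlowFrameU L₂ M₂ β U μ n).eval q| ≤
        (∑ m ∈ range n, d * (3 : ℝ) ^ m) / L₁) →
        ∀ (σ : Fin 2) (x₀ : SpaceTimeIdx L₁ M₂), imagTimeWeight β M₂ *
          ∑ x ∈ (univ : Finset (Fin 2 → SpaceTimeIdx L₁ M₂)).filter (fun x => x 0 = x₀ ∧ (x 1).2 ≠ (x 0).2),
            (1 + ((((x 1).2 - (x 0).2) 0).valMinAbs.natAbs : ℝ) + ((((x 1).2 - (x 0).2) 1).valMinAbs.natAbs : ℝ)) ^ 1 *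
              ‖sectorisedKernel L₁ M₂ β (trivialMultiplier L₁ M₂)
                  (klEffectiveAction L₁ M₂ β U μ (klFlowFrameU L₁ M₂ β U μ n) klE0 n - counterQuadratic L₁ M₂ β (klFlowFrameU L₁ M₂ β U μ n)) 2
                  (![((0, σ), 0), ((0, σ), 1)] : Fin 2 → SectorLeg 1) x‖ ≤ Ms n)
    (hdual : ∀ n ≤ N, ∀ (Mq : ℕ → ℕ) (L₁ L₂ M₂ : ℕ) [NeZero L₁] [NeZero L₂] [NeZero M₂], L ≤ L₁ → L₁ ∣ L₂ → Q.M0 β L₁ ≤ M₂ →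
      Mq L₁ ≤ M₂ → Q.M0 β L₂ ≤ M₂ → Mq L₂ ≤ M₂ →
      (∀ j < n, histV17F2 L₁ M₂ G P Q R β U μ j ∧ TwoLegSlopes L₁ M₂ R β U μ (klFlowFrameU L₁ M₂ β U μ j) j) →
      (∀ j < n, histV17F2 L₂ M₂ G P Q R β U μ j ∧ TwoLegSlopes L₂ M₂ R β U μ (klFlowFrameU L₂ M₂ β U μ j) j) →
      (∀ m < n, ∀ θ : ℝ, |klLocalPart L₁ M₂ β U μ (klFlowFrameU L₁ M₂ β U μ m) m θ -
        klLocalPart L₂ M₂ β U μ (klFlowFrameU L₂ M₂ β U μ m) m θ| ≤ d * (3 : ℝ) ^ m / L₁) →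
      (∀ q : Fin 2 → ℝ, |(klFlowFrameU L₁ M₂ β U μ n).eval q - (klFlowFrameU L₂ M₂ β U μ n).eval q| ≤
        (∑ m ∈ range n, d * (3 : ℝ) ^ m) / L₁) →
      ∃ (oc : SpaceTimeIdx L₁ M₂) (of : SpaceTimeIdx L₂ M₂),
        (∀ m ∈ ({omega0 M₂, (omega0 M₂).rev} : Finset (MatsubaraIdx M₂)), ∀ σ : Fin 2, imagTimeWeight β M₂ * ∑ ybar : TorusSite 2 L₁,
          (‖(∑ t₁ : ImagTimeIdx M₂,
              sectorisedKernel L₁ M₂ β (trivialMultiplier L₁ M₂)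
                  (klEffectiveAction L₁ M₂ β U μ (klFlowFrameU L₁ M₂ β U μ n) klE0 n - counterQuadratic L₁ M₂ β (klFlowFrameU L₁ M₂ β U μ n)) 2
                  (![((0, σ), 0), ((0, σ), 1)] : Fin 2 → SectorLeg 1) ![oc, (t₁, oc.2 + ybar)] *
                Complex.exp (((matsubaraFreq β M₂ m * (imagTime β M₂ oc.1 - imagTime β M₂ t₁) : ℝ) : ℂ) * I)) -
            (∑ t₁ : ImagTimeIdx M₂,
              sectorisedKernel L₂ M₂ β (trivialMultiplier L₂ M₂)
                  (klEffectiveAction L₂ M₂ β U μ (klFlowFrameU L₂ M₂ β U μ n) klE0 n - counterQuadratic L₂ M₂ β (klFlowFrameU L₂ M₂ β U μ n)) 2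
                  (![((0, σ), 0), ((0, σ), 1)] : Fin 2 → SectorLeg 1) ![of, (t₁, of.2 + Torus.proj L₂ (Torus.cRep ybar))] *
                Complex.exp (((matsubaraFreq β M₂ m * (imagTime β M₂ of.1 - imagTime β M₂ t₁) : ℝ) : ℂ) * I))‖ +
          ‖(∑ t₁ : ImagTimeIdx M₂,
              sectorisedKernel L₁ M₂ β (trivialMultiplier L₁ M₂)
                  (klEffectiveAction L₁ M₂ β U μ (klFlowFrameU L₁ M₂ β U μ n) klE0 n - counterQuadratic L₁ M₂ β (klFlowFrameU L₁ M₂ β U μ n)) 2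
                  (![((0, σ), 0), ((0, σ), 1)] : Fin 2 → SectorLeg 1) ![oc, (t₁, oc.2 + -ybar)] *
                Complex.exp (((matsubaraFreq β M₂ m * (imagTime β M₂ oc.1 - imagTime β M₂ t₁) : ℝ) : ℂ) * I)) -
            (∑ t₁ : ImagTimeIdx M₂,
              sectorisedKernel L₂ M₂ β (trivialMultiplier L₂ M₂)
                  (klEffectiveAction L₂ M₂ β U μ (klFlowFrameU L₂ M₂ β U μ n) klE0 n - counterQuadratic L₂ M₂ β (klFlowFrameU L₂ M₂ β U μ n)) 2
                  (![((0, σ), 0), ((0, σ), 1)] : Fin 2 → SectorLeg 1) ![of, (t₁, of.2 + -Torus.proj L₂ (Torus.cRep ybar))] *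
                Complex.exp (((matsubaraFreq β M₂ m * (imagTime β M₂ of.1 - imagTime β M₂ t₁) : ℝ) : ℂ) * I))‖) ≤ Dd n / L₁) ∧
        (∀ m ∈ ({omega0 M₂, (omega0 M₂).rev} : Finset (MatsubaraIdx M₂)), ∀ σ : Fin 2, imagTimeWeight β M₂ *
          ∑ y ∈ univ.filter (fun y : TorusSite 2 L₂ => Torus.proj L₂ (Torus.cRep (fun i => (((y i).val : ℕ) : ZMod L₁))) ≠ y),
          (‖(∑ t₁ : ImagTimeIdx M₂,
              sectorisedKernel L₂ M₂ β (trivialMultiplier L₂ M₂)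
                  (klEffectiveAction L₂ M₂ β U μ (klFlowFrameU L₂ M₂ β U μ n) klE0 n - counterQuadratic L₂ M₂ β (klFlowFrameU L₂ M₂ β U μ n)) 2
                  (![((0, σ), 0), ((0, σ), 1)] : Fin 2 → SectorLeg 1) ![of, (t₁, of.2 + y)] *
                Complex.exp (((matsubaraFreq β M₂ m * (imagTime β M₂ of.1 - imagTime β M₂ t₁) : ℝ) : ℂ) * I))‖ +
          ‖(∑ t₁ : ImagTimeIdx M₂,
              sectorisedKernel L₂ M₂ β (trivialMultiplier L₂ M₂)
                  (klEffectiveAction L₂ M₂ β U μ (klFlowFrameU L₂ M₂ β U μ n) klE0 n - counterQuadratic L₂ M₂ β (klFlowFrameU L₂ M₂ β U μ n)) 2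
                  (![((0, σ), 0), ((0, σ), 1)] : Fin 2 → SectorLeg 1) ![of, (t₁, of.2 + -y)] *
                Complex.exp (((matsubaraFreq β M₂ m * (imagTime β M₂ of.1 - imagTime β M₂ t₁) : ℝ) : ℂ) * I))‖) ≤ Df n / L₁)) :
    ∀ n ≤ N, ∀ (Mq : ℕ → ℕ) (L₁ L₂ M₂ : ℕ) [NeZero L₁] [NeZero L₂] [NeZero M₂], L ≤ L₁ → L₁ ∣ L₂ → Q.M0 β L₁ ≤ M₂ → Mq L₁ ≤ M₂ →
      Q.M0 β L₂ ≤ M₂ → Mq L₂ ≤ M₂ →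
      (∀ j < n, histV17F2 L₁ M₂ G P Q R β U μ j ∧ TwoLegSlopes L₁ M₂ R β U μ (klFlowFrameU L₁ M₂ β U μ j) j) →
      (∀ j < n, histV17F2 L₂ M₂ G P Q R β U μ j ∧ TwoLegSlopes L₂ M₂ R β U μ (klFlowFrameU L₂ M₂ β U μ j) j) →
        ∀ θ : ℝ, |klLocalPart L₁ M₂ β U μ (klFlowFrameU L₁ M₂ β U μ n) n θ -
          klLocalPart L₂ M₂ β U μ (klFlowFrameU L₂ M₂ β U μ n) n θ| ≤ Q.CL β n / 4 / L₁ := by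
  have hDpos : 0 < klCurveD := by unfold klCurveD; linarith [cDtmin_window_ge]
  refine spLeg_allScales_of_dualMoments_V17F2_rates (G := G) (P := P) (a := fun m => d * (3 : ℝ) ^ m) (Ms := Ms) (Dd := Dd) (Df := Df)
    hR hc hcle hU hUle hβmin hβc hμ hL h0 hN (fun n hn => ?_) hMs0 hMs hdual (fun n hn => ?_)
  · -- closure to the public ceiling: `d·3^n ≤ (Q.CL β 0/4)·4^n ≤ Q.CL β n/4`
    have h34 : (3 : ℝ) ^ n ≤ (4 : ℝ) ^ n := pow_le_pow_left₀ (by norm_num) (by norm_num) n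
    calc d * (3 : ℝ) ^ n ≤ Q.CL β 0 / 4 * (4 : ℝ) ^ n := mul_le_mul hdCL h34 (by positivity) (by linarith)
      _ = Q.CL β 0 * (4 : ℝ) ^ n / 4 := by ring
      _ ≤ Q.CL β n / 4 := div_le_div_of_nonneg_right (hCL n hn) (by norm_num)
  · -- the budget on geometric rates: `(b/klCurveD)·F + F + (Dd + Df) ≤ 2F + d = d·3^n`
    rw [sum_range_mul_three_pow]
    have hF0 : 0 ≤ d * ((3 : ℝ) ^ n - 1) / 2 := by
      have : (1 : ℝ) ≤ (3 : ℝ) ^ n := one_le_pow₀ (by norm_num)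
      have : 0 ≤ d * ((3 : ℝ) ^ n - 1) := mul_nonneg hd (by linarith)
      linarith
    have hb0 : 0 ≤ 2 * Ms n + 4 / 3 * R.Gfr 1 * U ^ 2 := by have := hMs0 n hn; have := hR 1; positivity
    have h1 : (2 * Ms n + 4 / 3 * R.Gfr 1 * U ^ 2) * (d * ((3 : ℝ) ^ n - 1) / 2) / klCurveD ≤ d * ((3 : ℝ) ^ n - 1) / 2 := by
      rw [div_le_iff₀ hDpos]
      calc (2 * Ms n + 4 / 3 * R.Gfr 1 * U ^ 2) * (d * ((3 : ℝ) ^ n - 1) / 2)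
          ≤ klCurveD * (d * ((3 : ℝ) ^ n - 1) / 2) := mul_le_mul_of_nonneg_right (hsmall n hn) hF0
        _ = d * ((3 : ℝ) ^ n - 1) / 2 * klCurveD := by ring
    have h2 := hDsum n hn
    have h3 : d * ((3 : ℝ) ^ n - 1) / 2 + (d * ((3 : ℝ) ^ n - 1) / 2 + Dd n + Df n) ≤ d * (3 : ℝ) ^ n := by linarith
    linarith

end V17F2

end Summit.HubbardSuperconductivity.HubbardSuperconductivity.Theorems.EngineV8

end
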